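import Summits.Ventures.CertifiedManyBodySolver.Downfold.RouterWordMonotone
import HarnessLib

/-!
# The TOKEN SET of a router verdict is monotone under inflation and CONSTANT along a hull that
# keeps an anchor — the kernel of INFLATION-RULES §P.12(e-tok)

Venture CertifiedManyBodySolver, cell `pub/hubbard-downfold` (HUMAN RULINGS D-0096/D-0098/D-0099:
stage S1 = DOWNFOLDING FRONT END = ROUTER; the P continuum of the phase map), seat
hubbard-downfold-mod-2; namespace `Summit.Ventures.CertifiedManyBodySolver.Downfold.Router`.
Everything here is PROVED. WHAT THIS IS NOT: a certified statement about any material, a physics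
threshold, or the decision table of record (`pub/hubbard-downfold/ROUTER.md` §3 /
`router/router.py`); the cell's table is an INSTANCE of `route`, and these theorems are what its
printed token strings inherit.

The cell prints a verdict as a TOKEN STRING: a table word prints its own tokens
(e.g. `UND:MIXED+1BH+EPH` for the mixed-regime row of ROUTER §3 R3a), and a `noRow` verdict
prints an «undetermined» token followed by the tokens of the live candidates
(`RouterWord.route`, `RouterWordMonotone`). §P.12(e) of `router/INFLATION-RULES.md` carries a
word across an open pressure interval when the SAME row fires at both end boxes; §P.12(e-tok)
(proposed 2026-08-27) asks when the printed TOKEN SET is constant although the REASON string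
changes inside the interval — e.g. one end of a ratio interval crossing one threshold (LuH₂ #68
on (3.7, 7.7) GPa: R3a `straddles θ_hi` at one end, `inside [θ_lo, θ_hi)` at the other). The
answer proved here, for a `Consistent` table:

* §1 `Verdict.tokens und tok` — the token set of a verdict (`und` = the tokens every `noRow`
  verdict carries, `tok w` = the tokens of the word `w`); `mem_candTokens`.
* §2 `tokens_subset_of_incl` — TOKENS ONLY GROW UNDER INFLATION: `S ⊆ S'` ⇒
  `tokens (route T S) ⊆ tokens (route T S')` (from `route_table_of_incl`,
  `route_table_mem_candidates_of_incl`, `route_candidates_subset_of_incl`).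
* §3 `tokens_eq_of_anchor` — THE (e-tok) CERTIFICATE: if a box `S` sits between an ANCHOR
  sub-box `A ⊆ S` on which the table fires the word `wA` and a HULL `H ⊇ S` whose token set is
  contained in `tok wA`, then `tokens (route T S) = tok wA` — whichever side of the threshold the
  moving end of `S` sits, and whatever reason string the diagnosis prints; `tokens_hull_eq_of_anchor`
  (the hull itself prints `tok wA`) and `tokens_eq_of_anchor_of_incl_hull` (the form used on a
  P interval: every box inside `S₁.hull S₂` that contains an anchor prints the same tokens as both
  ends). The two hypotheses are exactly the cell's (α) «the other end of the ratio interval keeps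
  its threshold region on the whole hull» (an anchor exists inside every box on the path) and (β)
  «the hull's printed token set equals the anchor word's» (read off the hull's own verdict).
-/

namespace Summit.Ventures.CertifiedManyBodySolver.Downfold

namespace Router

variable {ι : Type*} {ω : Type*} {τ : Type*} [DecidableEq τ]

/-! ## §1 Token sets -/

/-- The tokens of a candidate list: the union of the words' tokens. [folklore] -/
def candTokens (tok : ω → Finset τ) : List ω → Finset τ
  | [] => ∅
  | w :: ws => tok w ∪ candTokens tok ws

/-- Membership in `candTokens`: some candidate carries the token. [folklore] -/
theorem mem_candTokens {tok : ω → Finset τ} {t : τ} :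
    ∀ {cs : List ω}, t ∈ candTokens tok cs ↔ ∃ w ∈ cs, t ∈ tok w
  | [] => by simp [candTokens]
  | w :: ws => by
    rw [candTokens, Finset.mem_union, mem_candTokens]
    simp

/-- `candTokens` is monotone in the candidate list. [folklore] -/
theorem candTokens_mono {tok : ω → Finset τ} {cs cs' : List ω} (h : ∀ w ∈ cs, w ∈ cs') :
    candTokens tok cs ⊆ candTokens tok cs' := by
  intro t ht
  obtain ⟨w, hw, htw⟩ := mem_candTokens.1 ht
  exact mem_candTokens.2 ⟨w, h w hw, htw⟩

/-- A candidate's tokens are among the list's tokens. [folklore] -/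
theorem tok_subset_candTokens {tok : ω → Finset τ} {cs : List ω} {w : ω} (hw : w ∈ cs) :
    tok w ⊆ candTokens tok cs :=
  fun _ ht => mem_candTokens.2 ⟨w, hw, ht⟩

/-- **The TOKEN SET of a verdict**: a table word prints `tok w`; a `noRow` verdict prints the
«undetermined» tokens `und` and the tokens of its live candidates. [folklore] -/
def Verdict.tokens (und : Finset τ) (tok : ω → Finset τ) : Verdict ι ω → Finset τ
  | .table w => tok w
  | .noRow _ cs => und ∪ candTokens tok cs

/-- A table verdict prints its word's tokens. [folklore] -/
@[simp] theorem Verdict.tokens_table (und : Finset τ) (tok : ω → Finset τ) (w : ω) :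
    (Verdict.table w : Verdict ι ω).tokens und tok = tok w := rfl

/-- A `noRow` verdict prints `und` and its candidates' tokens. [folklore] -/
@[simp] theorem Verdict.tokens_noRow (und : Finset τ) (tok : ω → Finset τ) (why : BoxReason ι)
    (cs : List ω) : (Verdict.noRow why cs : Verdict ι ω).tokens und tok = und ∪ candTokens tok cs :=
  rfl

/-! ## §2 Tokens only grow under inflation -/

/-- **TOKENS ONLY GROW UNDER INFLATION.** For a consistent table and `S ⊆ S'`, every token the
box `S` prints is printed by `S'`: a table word survives or becomes a candidate
(`route_table_of_incl`, `route_table_mem_candidates_of_incl`), candidates stay candidates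
(`route_candidates_subset_of_incl`). [folklore] -/
theorem tokens_subset_of_incl {T : List (Row ι ω)} (hT : Consistent T) {S S' : Skel ι}
    (hSS' : S.Incl S') (und : Finset τ) (tok : ω → Finset τ) :
    (route T S).tokens und tok ⊆ (route T S').tokens und tok := by
  rcases hS' : route T S' with w' | ⟨why', cs'⟩
  · rw [route_table_of_incl hT hSS' hS']
  · rcases hS : route T S with w | ⟨why, cs⟩
    · rw [Verdict.tokens_table, Verdict.tokens_noRow]
      exact (tok_subset_candTokens (route_table_mem_candidates_of_incl hSS' hS hS')).trans
        Finset.subset_union_right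
    · rw [Verdict.tokens_noRow, Verdict.tokens_noRow]
      exact Finset.union_subset_union (le_refl und)
        (candTokens_mono (route_candidates_subset_of_incl hSS' hS hS'))

/-! ## §3 The (e-tok) certificate: tokens constant between an anchor and a hull -/

/-- **THE (e-tok) CERTIFICATE.** Consistent table; an ANCHOR box `A ⊆ S` routed to the table
word `wA`; a HULL `H ⊇ S` whose printed token set lies inside `tok wA`. Then the box `S` prints
exactly `tok wA` — whether a row fires on `S` or `S` straddles a threshold, and whatever reason
string its diagnosis reports. (Chain: `tok wA = tokens A ⊆ tokens S ⊆ tokens H ⊆ tok wA`.)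
[folklore] -/
theorem tokens_eq_of_anchor {T : List (Row ι ω)} (hT : Consistent T) {A S H : Skel ι}
    (hAS : A.Incl S) (hSH : S.Incl H) {wA : ω} (hA : route T A = .table wA) (und : Finset τ)
    (tok : ω → Finset τ) (hβ : (route T H).tokens und tok ⊆ tok wA) :
    (route T S).tokens und tok = tok wA := by
  refine Finset.Subset.antisymm ((tokens_subset_of_incl hT hSH und tok).trans hβ) ?_
  have h := tokens_subset_of_incl hT hAS und tok
  rwa [hA, Verdict.tokens_table] at h

/-- The hull itself prints `tok wA` under the same hypotheses. [folklore] -/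
theorem tokens_hull_eq_of_anchor {T : List (Row ι ω)} (hT : Consistent T) {A H : Skel ι}
    (hAH : A.Incl H) {wA : ω} (hA : route T A = .table wA) (und : Finset τ) (tok : ω → Finset τ)
    (hβ : (route T H).tokens und tok ⊆ tok wA) : (route T H).tokens und tok = tok wA :=
  tokens_eq_of_anchor hT hAH (Skel.Incl.refl H) hA und tok hβ

/-- (β) READ OFF A `noRow` HULL: if the hull prints `noRow why cs` and every candidate's tokens —
and the «undetermined» tokens — lie in `tok wA`, hypothesis (β) holds. (The cell's instance:
ROUTER §3 R3a straddling θ_hi prints candidates {mixed word, `1BH`}, whose tokens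
{UND:MIXED, 1BH, EPH} ∪ {1BH} are the mixed word's own.) [folklore] -/
theorem tokens_noRow_subset_of_forall {T : List (Row ι ω)} {H : Skel ι} {why : BoxReason ι}
    {cs : List ω} (hH : route T H = .noRow why cs) {und : Finset τ} {tok : ω → Finset τ} {wA : ω}
    (hund : und ⊆ tok wA) (hcs : ∀ w ∈ cs, tok w ⊆ tok wA) :
    (route T H).tokens und tok ⊆ tok wA := by
  rw [hH, Verdict.tokens_noRow]
  refine Finset.union_subset hund fun t ht => ?_
  obtain ⟨w, hw, htw⟩ := mem_candTokens.1 ht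
  exact hcs w hw htw

/-- **THE P-INTERVAL FORM (§P.12(e-tok)).** Two end boxes `S₁, S₂`; any box `S` inside their hull
(a box of the material at some pressure between the computed points, by the hull rules of
`PressureAxis`) that contains an anchor `A` on which the table fires `wA`; the hull's token set
inside `tok wA`. Then `S` prints `tok wA` — and so do `S₁`, `S₂` (take `S := S₁, S₂` with their own
anchors) and the hull: the printed tokens are CONSTANT across the interval although the reason
string may change where an interval end crosses a threshold. [folklore] -/
theorem tokens_eq_of_anchor_of_incl_hull {T : List (Row ι ω)} (hT : Consistent T)
    (S₁ S₂ : Skel ι) {A S : Skel ι} (hAS : A.Incl S) (hS : S.Incl (S₁.hull S₂)) {wA : ω}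
    (hA : route T A = .table wA) (und : Finset τ) (tok : ω → Finset τ)
    (hβ : (route T (S₁.hull S₂)).tokens und tok ⊆ tok wA) :
    (route T S).tokens und tok = tok wA :=
  tokens_eq_of_anchor hT hAS hS hA und tok hβ

/-- End-box corollary: each END box containing an anchor prints `tok wA`, hence both ends print
the same tokens (the premise §P.12(e) states as «same tokens at both ends» is itself a
consequence of (α)+(β)). [folklore] -/
theorem tokens_ends_eq_of_anchors {T : List (Row ι ω)} (hT : Consistent T) (S₁ S₂ : Skel ι)
    {A₁ A₂ : Skel ι} (h₁ : A₁.Incl S₁) (h₂ : A₂.Incl S₂) {wA : ω}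
    (hA₁ : route T A₁ = .table wA) (hA₂ : route T A₂ = .table wA) (und : Finset τ)
    (tok : ω → Finset τ) (hβ : (route T (S₁.hull S₂)).tokens und tok ⊆ tok wA) :
    (route T S₁).tokens und tok = tok wA ∧ (route T S₂).tokens und tok = tok wA :=
  ⟨tokens_eq_of_anchor hT h₁ (Skel.incl_hull_left S₁ S₂) hA₁ und tok hβ,
    tokens_eq_of_anchor hT h₂ (Skel.incl_hull_right S₁ S₂) hA₂ und tok hβ⟩

end Router

end Summit.Ventures.CertifiedManyBodySolver.Downfold
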